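import Mathlib.NumberTheory.NumberField.CMField
import Literature.FieldTheory.AlgClosed.AutFixedSubfield
import HarnessLib

/-!
# Totally real or CM: the number fields on which complex conjugation is well defined

Topic `NumberTheory/NumberFields`; theorems only (no definitions, no named facts).

Patrikis, *Variations on a theorem of Tate* (Mem. AMS 2019 = arXiv:1207.6724), §2 (Notation):
"By a CM field we mean as usual a quadratic totally imaginary extension of a totally real field;
these, and their real subfields, are the number fields on which complex conjugation is
well-defined, independent of the choice of complex embedding."  This file proves that folklore
characterisation in Mathlib's terms (`NumberField.IsTotallyReal`, `NumberField.IsCMField`,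
`NumberField.ComplexEmbedding.IsConj φ τ : conjugate φ = φ ∘ τ`):

* `isTotallyReal_or_isCMField_of_forall_isConj` — if ONE `ℚ`-automorphism `τ` of the number
  field `E` induces complex conjugation under EVERY embedding `E → ℂ`, then `E` is totally real
  (`τ = 1`) or CM (`τ ≠ 1`: `E` is totally complex, the fixed field of `τ` is totally real,
  and `E` is quadratic over it — Mathlib `IsCMField.ofCMExtension`);
* `isTotallyReal_or_isCMField_iff_exists_forall_isConj` — and conversely (`τ = 1` for totally
  real `E`, `τ = IsCMField.complexConj E` for CM `E`), i.e. the characterisation as an `iff`;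
* `Subfield.isTotallyReal_or_isCMField_of_conj_comm` — the `Aut(ℂ)` form used in descent
  arguments (e.g. Patrikis, Cor. 3.2.3: the field `ℚ(π_f)`): a subfield `E ⊆ ℂ`, finite over `ℚ`,
  such that `σ (z̄) = \overline{σ z}` for every automorphism `σ` of `ℂ` and every `z ∈ E`, is
  totally real or CM.  (Such `E` is stable under conjugation — the fixed field of `Aut(ℂ/E)` is
  `E`, `Complex.mem_subfield_of_forall_ringEquiv` — and every embedding of `E` is the restriction
  of an automorphism of `ℂ`, `Complex.exists_ringEquiv_apply_eq_of_subfield`, both from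
  `FieldTheory/AlgClosed/AutFixedSubfield`.)

Mathlib (pin v4.32.0) has the Galois case `IsCMField.of_forall_isConj` (`[IsGalois ℚ K]`,
`K` totally complex); the statements here drop both hypotheses.

## References

* S. Patrikis, *Variations on a theorem of Tate*, Mem. Amer. Math. Soc. 258 (2019), no. 1238
  (= arXiv:1207.6724), §2 (Notation) and Cor. 3.2.3. [Patrikis2019]
* S. Lang, *Algebra*, rev. 3rd ed., GTM 211 (2002), Ch. VIII §1. [Lang2002]
-/

noncomputable section

namespace Literature.NumberTheory.NumberFields

open NumberField NumberField.ComplexEmbedding NumberField.InfinitePlace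
open scoped ComplexConjugate Cardinal

section Abstract

variable {E : Type*} [Field E] [NumberField E]

omit [NumberField E] in
/-- A field all of whose complex embeddings are real is totally real (every infinite place is
`mk φ` for its embedding `φ`). [folklore] -/
theorem isTotallyReal_of_forall_isReal (h : ∀ φ : E →+* ℂ, ComplexEmbedding.IsReal φ) :
    IsTotallyReal E :=
  ⟨fun w ↦ isReal_iff.mpr (h w.embedding)⟩

/-- **A number field on which complex conjugation is well defined is totally real or CM.** If a
`ℚ`-automorphism `τ` of `E` satisfies `\overline{φ(x)} = φ(τ x)` for every embedding
`φ : E → ℂ` (`IsConj φ τ`), then either `τ = 1` and `E` is totally real, or `τ ≠ 1`, `E` is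
totally complex (a real embedding would force `τ = 1`), the fixed field `L` of `τ` is totally
real (the restriction of any `φ` to `L` is fixed by conjugation) with `[E : L] = |⟨τ⟩| = 2`, so
`E` is CM (`IsCMField.ofCMExtension`). Patrikis 2019, §2: CM fields "and their real subfields,
are the number fields on which complex conjugation is well-defined, independent of the choice of
complex embedding". [cite: Patrikis2019, §2 (Notation, arXiv:1207.6724)] -/
theorem isTotallyReal_or_isCMField_of_forall_isConj (τ : E ≃ₐ[ℚ] E)
    (hτ : ∀ φ : E →+* ℂ, IsConj φ τ) : IsTotallyReal E ∨ IsCMField E := by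
  by_cases h1 : τ = 1
  · subst h1
    exact Or.inl (isTotallyReal_of_forall_isReal fun φ ↦ isConj_one_iff.mp (hτ φ))
  right
  -- `E` is totally complex
  haveI : IsTotallyComplex E := ⟨fun w ↦ not_isReal_iff_isComplex.mp fun hw ↦
    (isConj_ne_one_iff (hτ w.embedding)).mp h1 (isReal_iff.mp hw)⟩
  -- `τ` fixes the fixed field of `⟨τ⟩` and is an automorphism over it
  have hτL : τ ∈ (IntermediateField.fixedField (Subgroup.zpowers τ)).fixingSubgroup :=
    (IntermediateField.le_iff_le _ _).mp le_rfl (Subgroup.mem_zpowers τ)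
  have hg : ∀ φ : E →+* ℂ, IsConj φ
      (IntermediateField.fixingSubgroupEquiv
        (IntermediateField.fixedField (Subgroup.zpowers τ)) ⟨τ, hτL⟩) :=
    fun φ ↦ (hτ φ).trans (RingHom.ext fun _ ↦ rfl)
  -- the fixed field is totally real
  haveI : IsTotallyReal (IntermediateField.fixedField (Subgroup.zpowers τ)) := ⟨fun w ↦ by
    obtain ⟨W, rfl⟩ := w.comap_surjective (K := E)
    dsimp only
    rw [← mk_embedding W, comap_mk, isReal_mk_iff]
    exact (hg W.embedding).isReal_comp⟩
  -- and `E` is quadratic over it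
  haveI : Algebra.IsQuadraticExtension (IntermediateField.fixedField (Subgroup.zpowers τ)) E :=
      ⟨by
    obtain ⟨φ⟩ : Nonempty (E →+* ℂ) := inferInstance
    rw [IntermediateField.finrank_fixedField_eq_card, Nat.card_zpowers,
      orderOf_isConj_two_of_ne_one (hτ φ) h1]⟩
  exact IsCMField.ofCMExtension (IntermediateField.fixedField (Subgroup.zpowers τ)) E

/-- On a totally real field the identity induces complex conjugation under every embedding.
[folklore] -/
theorem forall_isConj_one_of_isTotallyReal [IsTotallyReal E] (φ : E →+* ℂ) :
    IsConj φ (1 : E ≃ₐ[ℚ] E) :=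
  isConj_one_iff.mpr (IsTotallyReal.complexEmbedding_isReal φ)

/-- On a CM field the complex conjugation `IsCMField.complexConj E` (an automorphism over the
maximal real subfield, here viewed over `ℚ`) induces complex conjugation under every embedding
(Mathlib `IsCMField.isConj_complexConj`). [folklore] -/
theorem forall_isConj_complexConj_of_isCMField [IsCMField E] (φ : E →+* ℂ) :
    IsConj φ ((IsCMField.complexConj E).restrictScalars ℚ) :=
  IsCMField.isConj_complexConj E φ

/-- **Totally real or CM ⟺ complex conjugation is well defined**: a number field `E` is totally
real or CM iff some `ℚ`-automorphism of `E` induces complex conjugation under every complex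
embedding (Patrikis 2019, §2). [cite: Patrikis2019, §2 (Notation, arXiv:1207.6724)] -/
theorem isTotallyReal_or_isCMField_iff_exists_forall_isConj :
    (IsTotallyReal E ∨ IsCMField E) ↔ ∃ τ : E ≃ₐ[ℚ] E, ∀ φ : E →+* ℂ, IsConj φ τ := by
  constructor
  · rintro (h | h)
    · exact ⟨1, forall_isConj_one_of_isTotallyReal⟩
    · exact ⟨_, forall_isConj_complexConj_of_isCMField⟩
  · rintro ⟨τ, hτ⟩
    exact isTotallyReal_or_isCMField_of_forall_isConj τ hτ

end Abstract

/-! ### Subfields of `ℂ`: the `Aut(ℂ)` form -/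

section Complex

open Literature.FieldTheory.AlgClosed

/-- If complex conjugation commutes, on the countable subfield `E ⊆ ℂ`, with every automorphism
of `ℂ`, then `E` is stable under complex conjugation: `z̄` is fixed by `Aut(ℂ/E)` for `z ∈ E`,
and the fixed field of `Aut(ℂ/E)` is `E` (`Complex.mem_subfield_of_forall_ringEquiv`).
[cite: Lang2002, Ch. VIII §1] -/
theorem Subfield.conj_mem_of_conj_comm (E : Subfield ℂ) (hE : #E ≤ ℵ₀)
    (hcomm : ∀ σ : ℂ ≃+* ℂ, ∀ z ∈ E, σ (conj z) = conj (σ z)) {z : ℂ} (hz : z ∈ E) :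
    conj z ∈ E :=
  Complex.mem_subfield_of_forall_ringEquiv E hE fun σ hσ ↦ by rw [hcomm σ z hz, hσ z hz]

/-- **A subfield of `ℂ`, finite over `ℚ`, on which complex conjugation commutes with `Aut(ℂ)` is
totally real or CM.** If `σ (z̄) = \overline{σ z}` for all automorphisms `σ` of `ℂ` and all
`z ∈ E`, then `E` is conjugation-stable (`Subfield.conj_mem_of_conj_comm`), conjugation restricts
to a `ℚ`-automorphism `τ` of `E`, and `τ` induces complex conjugation under EVERY embedding
`φ : E → ℂ`, because `φ` is the restriction of an automorphism of `ℂ`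
(`Complex.exists_ringEquiv_apply_eq_of_subfield`); conclude by
`isTotallyReal_or_isCMField_of_forall_isConj`. This is the step "… and therefore the fixed
field `ℚ(π_f)` of `{σ ∈ Aut(ℂ) : ^σπ ≅ π}` is CM" of Patrikis 2019, Cor. 3.2.3 (CM in his broad
sense: CM or totally real). [cite: Patrikis2019, Cor. 3.2.3 (arXiv:1207.6724)] -/
theorem Subfield.isTotallyReal_or_isCMField_of_conj_comm (E : Subfield ℂ) [FiniteDimensional ℚ E]
    (hcomm : ∀ σ : ℂ ≃+* ℂ, ∀ z ∈ E, σ (conj z) = conj (σ z)) :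
    IsTotallyReal E ∨ IsCMField E := by
  haveI : Algebra.IsAlgebraic ℚ E := Algebra.IsAlgebraic.of_finite ℚ E
  have hE : #E ≤ ℵ₀ := Subfield.cardinalMk_le_aleph0_of_isAlgebraic E
  have hcE : ∀ z ∈ E, conj z ∈ E := fun z hz ↦ Subfield.conj_mem_of_conj_comm E hE hcomm hz
  haveI : NumberField E := { to_charZero := inferInstance, to_finiteDimensional := ‹_› }
  -- complex conjugation restricted to `E`
  let τr : E ≃+* E :=
    { toFun := fun x ↦ ⟨conj (x : ℂ), hcE x x.2⟩
      invFun := fun x ↦ ⟨conj (x : ℂ), hcE x x.2⟩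
      left_inv := fun x ↦ Subtype.ext (Complex.conj_conj _)
      right_inv := fun x ↦ Subtype.ext (Complex.conj_conj _)
      map_mul' := fun x y ↦ Subtype.ext (map_mul _ _ _)
      map_add' := fun x y ↦ Subtype.ext (map_add _ _ _) }
  have hτr : ∀ x : E, ((τr x : E) : ℂ) = conj (x : ℂ) := fun _ ↦ rfl
  let τ : E ≃ₐ[ℚ] E := AlgEquiv.ofRingEquiv (f := τr) fun q ↦ Subtype.ext (by
    rw [hτr]
    simp)
  refine isTotallyReal_or_isCMField_of_forall_isConj τ fun φ ↦ ?_
  -- `φ` is the restriction of an automorphism `σ` of `ℂ`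
  obtain ⟨σ, hσ⟩ := Complex.exists_ringEquiv_apply_eq_of_subfield E hE φ
  refine RingHom.ext fun x ↦ ?_
  rw [conjugate_coe_eq, RingHom.comp_apply, ← hσ x]
  change conj (σ x) = φ (τr x)
  rw [← hσ (τr x), hτr]
  exact (hcomm σ x x.2).symm

end Complex

end Literature.NumberTheory.NumberFields
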